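import Summits.Ventures.DiscreteObjects.UnitDistance.KernelRupCnfValid
import Summits.Ventures.DiscreteObjects.UnitDistance.FiniteFieldLowerBoundF19Data
import HarnessLib

/-!
# The 3-colouring CNF generated from adjacency lists in `O(n + m)` (`cnfOfAdj`) and its admissibility

Framing (verbatim for the cell): lottery ticket; floor = certified bounds/negative ranges.

Cell `pub-namedobj`, target (U), seat udg g14.  `KRup.cnfOf nb n v₀ v₁` (in `KernelRupColouring.lean`) filters, for every
vertex `v`, ALL `w < n` through `Nat.testBit (nb v) w`: `n²` bit tests, which is what each kernel RUP piece of the large witnesses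
pays for (≈ 200 s per piece at `n = 909`).  For witnesses given by adjacency LISTS (`w<d>adj`, neighbour words
`nb v = listBits (adj.getD v [])`) the same clauses — in the same order when the lists are increasing — are produced in `O(n + m)` by
`cnfOfAdj adj n v₀ v₁`.  Soundness needs no new argument: every clause of `cnfOfAdj` passes the recogniser `KRup.validClause nb n v₀ v₁`
as soon as listed neighbours are set bits of `nb` (`cnfOfAdj_all_valid_of`; for `nb = listBits ∘ adj.getD · []` this is
`testBit_listBits_of_mem`, giving `cnfOfAdj_all_valid`), so `KRup.all_true_of_valid` / `KRup.checkAll_sound` apply verbatim to RUP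
runs on `Store.ofList d (cnfOfAdj adj n v₀ v₁ ++ …)`.
-/

namespace Summit.Ventures.DiscreteObjects.UnitDistance

/-- A member of `l` is a set bit of `listBits l` (converse of `mem_of_testBit_listBits`). -/
theorem testBit_listBits_of_mem : ∀ (l : List ℕ) (w : ℕ), w ∈ l → Nat.testBit (listBits l) w = true
  | [], w, h => by simp at h
  | a :: l, w, h => by
      have h' : Nat.testBit (2 ^ a ||| listBits l) w = true := by
        rw [Nat.testBit_lor, Bool.or_eq_true, Nat.testBit_two_pow, decide_eq_true_eq]
        rcases List.mem_cons.1 h with rfl | h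
        · exact Or.inl rfl
        · exact Or.inr (testBit_listBits_of_mem l w h)
      exact h'

namespace KRup

/-- Edge clauses of vertex `v` read off its adjacency list: listed neighbours `w` with `v < w < n`, three colours each. -/
def edgeClausesAdj (adj : List (List ℕ)) (n v : ℕ) : List (List ℕ) :=
  ((adj.getD v []).filter fun w => v < w && w < n).flatMap fun w =>
    [[negl v 0, negl w 0], [negl v 1, negl w 1], [negl v 2, negl w 2]]

/-- THE CNF FROM ADJACENCY LISTS: vertex clauses, edge clauses (per vertex, in list order), the two symmetry-breaking units —
the clause order of `cnfOf` when every list is increasing. -/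
def cnfOfAdj (adj : List (List ℕ)) (n v₀ v₁ : ℕ) : List (List ℕ) :=
  ((List.range n).map fun v => [pos v 0, pos v 1, pos v 2]) ++
    ((List.range n).flatMap fun v => edgeClausesAdj adj n v) ++ [[pos v₀ 0], [pos v₁ 1]]

/-- ADMISSIBILITY: if every listed neighbour `w ∈ adj[v]` is a set bit of `nb v`, every clause of `cnfOfAdj adj n v₀ v₁` passes
the recogniser `validClause nb n v₀ v₁`. -/
theorem cnfOfAdj_all_valid_of {nb : ℕ → ℕ} {adj : List (List ℕ)}
    (h : ∀ v w, w ∈ adj.getD v [] → Nat.testBit (nb v) w = true) (n v₀ v₁ : ℕ) :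
    (cnfOfAdj adj n v₀ v₁).all (validClause nb n v₀ v₁) = true := by
  rw [List.all_eq_true]
  intro C hC
  simp only [cnfOfAdj, List.mem_append, List.mem_map, List.mem_range, List.mem_flatMap, List.mem_cons,
    List.not_mem_nil, or_false] at hC
  rcases hC with (⟨v, hv, rfl⟩ | ⟨v, hv, hC⟩) | rfl | rfl
  · exact validClause_vertex nb n v₀ v₁ hv
  · simp only [edgeClausesAdj, List.mem_flatMap, List.mem_filter, Bool.and_eq_true, decide_eq_true_eq,
      List.mem_cons, List.not_mem_nil, or_false] at hC
    obtain ⟨w, ⟨hmem, _, hw⟩, hC⟩ := hC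
    have hbit := h v w hmem
    rcases hC with rfl | rfl | rfl
    · exact validClause_edge nb n v₀ v₁ hv hw hbit (by omega)
    · exact validClause_edge nb n v₀ v₁ hv hw hbit (by omega)
    · exact validClause_edge nb n v₀ v₁ hv hw hbit (by omega)
  · simp [validClause]
  · simp [validClause]

/-- ADMISSIBILITY for the neighbour words of the lists themselves (`nb v = listBits adj[v]`). -/
theorem cnfOfAdj_all_valid (adj : List (List ℕ)) (n v₀ v₁ : ℕ) :
    (cnfOfAdj adj n v₀ v₁).all (validClause (fun v => listBits (adj.getD v [])) n v₀ v₁) = true :=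
  cnfOfAdj_all_valid_of (fun _ _ hw => testBit_listBits_of_mem _ _ hw) n v₀ v₁

end KRup

end Summit.Ventures.DiscreteObjects.UnitDistance
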